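import Summits.Ventures.PercRepro.C025ProfileGenDemDA

/-!
# The general certificate: (Dem)(d) — a pair on a long line receives its demand, in every rank (night-3 g8)

NIGHT3-G8-GENERAL-CERTIFICATE.md §2(d), in the kernel: `B` a pair with `j(B) = 2` in a simple matroid of rank `≥ 4`,
`p = ρ(E∖B) ≥ 4`, `T = cl B ∖ B` (`t ≥ 2`), `F = E ∖ cl B` (`f ≥ p − 2`). The supersets `B ∪ {y}` (`y ∈ F`) and
`B ∪ {z, y}` (`z ∈ T`, `y ∈ F`) pay, grouped by `y`, at least `b` each with `f·b ≥ p`: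
* `f ≥ p`: `b = 1` (every three-set pays `≥ 1`);
* `f = p − 1`: `b = p/(p−1)` — a coloop `y` (`r_y = p − 1`) pays `(p+2)/p ≥ p/(p−1)` on its three-set alone; a
  non-coloop `y` pays `1` there and `1/(p−1)` on its four-sets (`t = 2`: two sets at `1/(2(p−1))`, since
  `p − 1 ≤ r_zy ≤ f = p − 1`; `t ≥ 3`: `t` sets at `1/(3(p−1))`, since `r_zy = r_y = p`);
* `f = p − 2`: `b = p/(p−2)` — every `y` is a coloop (`r_y ≤ f + 1 = p − 1`), paying `(p+2)/p`, and its four-sets pay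
  `4/(p(p−2))` (`t = 2`: `r_zy = p − 2`) or `≥ 3/(2(p−1))` (`t ≥ 3`: `r_zy = r_y = p − 1`); `(p+2)/p + 4/(p(p−2)) = p/(p−2)`
  and `(p+2)/p + 3/(2(p−1)) ≥ p/(p−2)` (`(3p−2)(p−4) ≥ 0`).
-/

open scoped Matroid

namespace PercRepro

open Set Finset ThmH

section GenDemD

variable {α : Type} [DecidableEq α] {M : Matroid α} [M.Finite]

/-- Arithmetic: `(p+2)/p ≥ p/(p−1)` for `p ≥ 2`. -/
theorem coloop_bonus_ge {p : ℚ} (hp : 2 ≤ p) : p / (p - 1) ≤ (p + 2) / p := by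
  rw [div_le_div_iff₀ (by linarith) (by linarith)]; nlinarith

/-- Arithmetic: `(p+2)/p + 4/(p(p−2)) = p/(p−2)` for `p > 2`. -/
theorem tight_two_eq {p : ℚ} (hp : 4 ≤ p) : (p + 2) / p + 2 * (2 / (p * (p - 2))) = p / (p - 2) := by
  have h1 : p ≠ 0 := by linarith
  have h2 : p - 2 ≠ 0 := by linarith
  field_simp
  ring

/-- Arithmetic: `(p+2)/p + 3/(2(p−1)) ≥ p/(p−2)` for `p ≥ 4`. -/
theorem tight_three_ge {p : ℚ} (hp : 4 ≤ p) : p / (p - 2) ≤ (p + 2) / p + 3 * (1 / (2 * (p - 1))) := by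
  have h1 : (0 : ℚ) < p := by linarith
  have h2 : (0 : ℚ) < p - 2 := by linarith
  have h3 : (0 : ℚ) < p - 1 := by linarith
  have e : (p + 2) / p + 3 * (1 / (2 * (p - 1))) = (2 * (p + 2) * (p - 1) + 3 * p) / (2 * p * (p - 1)) := by
    field_simp
  rw [e, div_le_div_iff₀ h2 (by positivity)]
  nlinarith

/-- **(Dem)(d) in every rank `≥ 4`**: a pair `B` whose line has at least two further points (`j(B) = 2`) receives at
least `ρ(E∖B)` under `wgn`. -/
theorem dem_wgn_of_jB_eq_two (hR : (4 : ℕ∞) ≤ M.eRank) (hsimple : ∀ T ⊆ M.E, T.encard ≤ 2 → M.Indep T)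
    {B : Finset α} (hB : B ∈ Profile.Rq M 2) (hBc : B.card = 2) (hj : jB M B = 2) :
    (crk M B : ℚ) ≤ ∑ S ∈ (Shadow.levelSet M 3).filter (fun S => B ⊆ S), wgn M B S := by
  classical
  have hp4 : 4 ≤ crk M B := four_le_crk_of_jB_eq_two hR hsimple hB hj
  have hBmem := hB
  rw [Profile.mem_Rq] at hB
  obtain ⟨hBg, hB2⟩ := hB
  set T := clF M B \ B with hT
  set F := gr M \ clF M B with hF
  set p := crk M B with hpdef
  have hpq : (4 : ℚ) ≤ (p : ℚ) := by exact_mod_cast hp4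
  have hT2 : 2 ≤ T.card := by
    have hc : (clF M B \ B).card = (clF M B).card - B.card := Finset.card_sdiff_of_subset (subset_clF_self hBg)
    unfold jB at hj
    rw [hT, hc]
    omega
  have hFp : p ≤ F.card + 2 := by
    have hFT : gr M \ B = F ∪ T := gr_sdiff_eq_union hBg
    have hTj : M.eRk ((T : Finset α) : Set α) ≤ (2 : ℕ∞) := by
      have := eRk_clF_sdiff_le_jB hBg hB2
      rw [hj] at this
      exact_mod_cast this
    have hFcard : M.eRk ((F : Finset α) : Set α) ≤ (F.card : ℕ∞) := by
      rw [← Set.encard_coe_eq_coe_finsetCard]; exact M.eRk_le_encard _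
    have : (p : ℕ∞) ≤ (F.card : ℕ∞) + 2 := by
      rw [hpdef, ← eRk_gr_sdiff_eq_crk, hFT, Finset.coe_union]
      calc M.eRk ((F : Finset α) ∪ (T : Finset α) : Set α) ≤ M.eRk (F : Set α) + M.eRk (T : Set α) :=
            M.eRk_union_le_eRk_add_eRk _ _
        _ ≤ (F.card : ℕ∞) + 2 := add_le_add hFcard hTj
    exact_mod_cast this
  have hF2 : 2 ≤ F.card := by omega
  have hTF : ∀ z ∈ T, ∀ y ∈ F, y ≠ z := by
    intro z hz y hy h
    rw [h] at hy
    exact (Finset.mem_sdiff.1 hy).2 (Finset.mem_sdiff.1 hz).1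
  -- the values
  have hA : ∀ y ∈ F, wgn M B (insert y B) =
      (if crk M (insert y B) + 1 = p then ((p : ℚ) + 2) / (p : ℚ) else 1) := fun y hy =>
    wgn_insert_eq_of_jB_eq_two hBg hBc hj (by omega) hy
  have hD : ∀ z ∈ T, ∀ y ∈ F, wgn M B (insert y (insert z B)) =
      (if crk M (insert y (insert z B)) + 2 = p then 2 / ((p : ℚ) * ((p : ℚ) - 2))
       else if crk M (insert y (insert z B)) + 1 = p then 1 / (2 * ((p : ℚ) - 1))
       else if crk M (insert y (insert z B)) = p then 1 / (3 * ((p : ℚ) - 1)) else 0) := fun z hz y hy =>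
    wgn_insert_insert_eq_of_jB_eq_two hBg hBc hj hp4 hz hy
  -- the rank facts
  have hG1 : ∀ y ∈ F, p ≤ crk M (insert y B) + 1 ∧ crk M (insert y B) ≤ p := fun y hy =>
    ⟨crk_le_crk_insert_add_one hBg hy, crk_le_crk_of_subset (Finset.subset_insert _ _)⟩
  have hG2 : ∀ z ∈ T, ∀ y ∈ F, crk M (insert y B) ≤ crk M (insert y (insert z B)) + 1 ∧
      crk M (insert y (insert z B)) ≤ crk M (insert y B) := fun z hz y hy =>
    ⟨crk_insert_le_crk_insert_insert_add_one hBg hz hy, crk_insert_insert_le_crk_insert⟩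
  have hG3 : 3 ≤ T.card → ∀ z ∈ T, ∀ y ∈ F, crk M (insert y (insert z B)) = crk M (insert y B) :=
    fun h3 z hz y hy => crk_insert_insert_eq_of_three_le hsimple hBmem hz hy h3
  have hG4 : T.card = 2 → ∀ z ∈ T, ∀ y ∈ F, crk M (insert y (insert z B)) ≤ F.card :=
    fun h2 z hz y hy => crk_insert_insert_le_card_of_two hsimple hBmem hz hy h2 hF2
  have hfy : ∀ y ∈ F, crk M (insert y B) ≤ F.card + 1 := fun y hy =>
    crk_insert_le_card_add_one hBmem hy (by rw [← hF]; omega)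
  -- the two families of supersets and the lower bound on the total
  have hinjA : Set.InjOn (fun y => insert y B) (F : Set α) := by
    intro y hy y' hy' h
    simp only at h
    rw [Finset.mem_coe] at hy hy'
    have : y ∈ insert y' B := by rw [← h]; exact Finset.mem_insert_self _ _
    rw [Finset.mem_insert] at this
    rcases this with h' | h'
    · exact h'
    · exact absurd h' (mem_F_facts hBg hy).2.2.1
  have hsubA : F.image (fun y => insert y B) ⊆ (Shadow.levelSet M 3).filter (fun S => B ⊆ S) := by
    intro S hS; rw [Finset.mem_image] at hS; obtain ⟨y, hy, rfl⟩ := hS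
    exact insert_mem_filter_of_mem_F hBmem hy
  have hinjD : Set.InjOn (fun q : α × α => insert q.2 (insert q.1 B)) ((T ×ˢ F : Finset (α × α)) : Set (α × α)) := by
    rintro ⟨z, y⟩ hq ⟨z', y'⟩ hq' h
    simp only at h
    rw [Finset.mem_coe, Finset.mem_product] at hq hq'
    obtain ⟨hz, hy⟩ := hq
    obtain ⟨hz', hy'⟩ := hq'
    have hyB : y ∉ B := (mem_F_facts hBg hy).2.2.1
    have hzB : z ∉ B := (Finset.mem_sdiff.1 hz).2
    have h1 : y ∈ insert y' (insert z' B) := by rw [← h]; exact Finset.mem_insert_self _ _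
    rw [Finset.mem_insert, Finset.mem_insert] at h1
    rcases h1 with rfl | rfl | h1
    · have h2 : z ∈ insert y (insert z' B) := by rw [← h]; exact Finset.mem_insert_of_mem (Finset.mem_insert_self _ _)
      rw [Finset.mem_insert, Finset.mem_insert] at h2
      rcases h2 with rfl | rfl | h2
      · exact absurd rfl (hTF z hz z hy)
      · rfl
      · exact absurd h2 hzB
    · exact absurd rfl (hTF y hz' y hy)
    · exact absurd h1 hyB
  have hsubD : (T ×ˢ F).image (fun q : α × α => insert q.2 (insert q.1 B)) ⊆
      (Shadow.levelSet M 3).filter (fun S => B ⊆ S) := by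
    intro S hS; rw [Finset.mem_image] at hS; obtain ⟨⟨z, y⟩, hq, rfl⟩ := hS
    rw [Finset.mem_product] at hq
    exact insert_insert_mem_filter_of_mem_T_F hBmem hq.1 hq.2
  have hdisj : Disjoint (F.image (fun y => insert y B))
      ((T ×ˢ F).image (fun q : α × α => insert q.2 (insert q.1 B))) := by
    rw [Finset.disjoint_left]
    intro S hS1 hS2
    rw [Finset.mem_image] at hS1 hS2
    obtain ⟨y, hy, rfl⟩ := hS1
    obtain ⟨⟨z', y'⟩, hq', hh⟩ := hS2
    rw [Finset.mem_product] at hq'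
    simp only at hh
    have hc1 : (insert y B).card = 3 := by
      rw [Finset.card_insert_of_notMem (mem_F_facts hBg hy).2.2.1, hBc]
    have hc2 : (insert y' (insert z' B)).card = 4 := by
      rw [Finset.card_insert_of_notMem, Finset.card_insert_of_notMem (Finset.mem_sdiff.1 hq'.1).2, hBc]
      rw [Finset.mem_insert, not_or]
      exact ⟨hTF z' hq'.1 y' hq'.2, (mem_F_facts hBg hq'.2).2.2.1⟩
    rw [hh] at hc2
    omega
  have hlow : ∑ y ∈ F, wgn M B (insert y B) +
      ∑ q ∈ T ×ˢ F, wgn M B (insert q.2 (insert q.1 B)) ≤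
      ∑ S ∈ (Shadow.levelSet M 3).filter (fun S => B ⊆ S), wgn M B S := by
    rw [← Finset.sum_image hinjA, ← Finset.sum_image hinjD, ← Finset.sum_union hdisj]
    exact Finset.sum_le_sum_of_subset_of_nonneg (Finset.union_subset hsubA hsubD) (fun S _ _ => wgn_nonneg B S)
  -- regroup by y
  have hregroup : ∑ y ∈ F, wgn M B (insert y B) + ∑ q ∈ T ×ˢ F, wgn M B (insert q.2 (insert q.1 B)) =
      ∑ y ∈ F, (wgn M B (insert y B) + ∑ z ∈ T, wgn M B (insert y (insert z B))) := by
    rw [Finset.sum_product_right, ← Finset.sum_add_distrib]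
  rw [hregroup] at hlow
  -- the per-y bound
  have hA1 : ∀ y ∈ F, 1 ≤ wgn M B (insert y B) := by
    intro y hy
    rw [hA y hy]
    split_ifs
    · rw [le_div_iff₀ (by linarith)]; linarith
    · exact le_rfl
  have hDnn : ∀ y ∈ F, 0 ≤ ∑ z ∈ T, wgn M B (insert y (insert z B)) :=
    fun y _ => Finset.sum_nonneg (fun z _ => wgn_nonneg _ _)
  have hsum_ge : ∀ b : ℚ, (∀ y ∈ F, b ≤ wgn M B (insert y B) + ∑ z ∈ T, wgn M B (insert y (insert z B))) →
      (F.card : ℚ) * b ≤ ∑ y ∈ F, (wgn M B (insert y B) + ∑ z ∈ T, wgn M B (insert y (insert z B))) := by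
    intro b hb
    rw [← nsmul_eq_mul, ← Finset.sum_const]
    exact Finset.sum_le_sum hb
  rcases le_or_gt p F.card with hfp | hfp
  · -- f ≥ p
    have := hsum_ge 1 (fun y hy => by linarith [hA1 y hy, hDnn y hy])
    have : (p : ℚ) ≤ (F.card : ℚ) := by exact_mod_cast hfp
    linarith
  rcases Nat.lt_or_ge F.card (p - 1) with hfp2 | hfp1
  · -- f = p − 2
    have hf : F.card = p - 2 := by omega
    have hfq : (F.card : ℚ) = (p : ℚ) - 2 := by rw [hf, Nat.cast_sub (by omega)]; push_cast; ring
    have hper : ∀ y ∈ F, (p : ℚ) / ((p : ℚ) - 2) ≤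
        wgn M B (insert y B) + ∑ z ∈ T, wgn M B (insert y (insert z B)) := by
      intro y hy
      have hry : crk M (insert y B) + 1 = p := by
        have := hfy y hy; have := (hG1 y hy).1; omega
      rw [hA y hy, if_pos hry]
      rcases Nat.lt_or_ge T.card 3 with ht2 | ht3
      · have ht : T.card = 2 := by omega
        have hval : ∀ z ∈ T, wgn M B (insert y (insert z B)) = 2 / ((p : ℚ) * ((p : ℚ) - 2)) := by
          intro z hz
          rw [hD z hz y hy]
          have h1 := hG4 ht z hz y hy
          have h2 := (hG2 z hz y hy).1
          rw [if_pos (by omega)]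
        rw [Finset.sum_congr rfl hval, Finset.sum_const, nsmul_eq_mul, ht]
        push_cast
        rw [tight_two_eq hpq]
      · have hval : ∀ z ∈ T, wgn M B (insert y (insert z B)) = 1 / (2 * ((p : ℚ) - 1)) := by
          intro z hz
          rw [hD z hz y hy, hG3 ht3 z hz y hy]
          rw [if_neg (by omega), if_pos hry]
        rw [Finset.sum_congr rfl hval, Finset.sum_const, nsmul_eq_mul]
        have ht3q : (3 : ℚ) ≤ (T.card : ℚ) := by exact_mod_cast ht3
        have hpos : (0 : ℚ) ≤ 1 / (2 * ((p : ℚ) - 1)) := div_nonneg zero_le_one (by linarith)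
        have := tight_three_ge hpq
        nlinarith
    have := hsum_ge _ hper
    rw [hfq] at this
    have hne : (p : ℚ) - 2 ≠ 0 := by linarith
    have : ((p : ℚ) - 2) * ((p : ℚ) / ((p : ℚ) - 2)) = (p : ℚ) := by field_simp
    linarith
  · -- f = p − 1
    have hf : F.card = p - 1 := by omega
    have hfq : (F.card : ℚ) = (p : ℚ) - 1 := by rw [hf, Nat.cast_sub (by omega)]; push_cast; ring
    have hper : ∀ y ∈ F, (p : ℚ) / ((p : ℚ) - 1) ≤
        wgn M B (insert y B) + ∑ z ∈ T, wgn M B (insert y (insert z B)) := by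
      intro y hy
      by_cases hry : crk M (insert y B) + 1 = p
      · -- a coloop: the three-set alone pays (p+2)/p ≥ p/(p−1)
        rw [hA y hy, if_pos hry]
        have := coloop_bonus_ge (by linarith : (2 : ℚ) ≤ (p : ℚ))
        linarith [hDnn y hy]
      · -- not a coloop: r_y = p; the three-set pays 1, the four-sets pay ≥ 1/(p−1)
        have hryp : crk M (insert y B) = p := by have := hG1 y hy; omega
        rw [hA y hy, if_neg hry]
        have hkey : 1 / ((p : ℚ) - 1) ≤ ∑ z ∈ T, wgn M B (insert y (insert z B)) := by
          rcases Nat.lt_or_ge T.card 3 with ht2 | ht3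
          · have ht : T.card = 2 := by omega
            have hval : ∀ z ∈ T, wgn M B (insert y (insert z B)) = 1 / (2 * ((p : ℚ) - 1)) := by
              intro z hz
              rw [hD z hz y hy]
              have h1 := hG4 ht z hz y hy
              have h2 := (hG2 z hz y hy).1
              rw [if_neg (by omega), if_pos (by omega)]
            rw [Finset.sum_congr rfl hval, Finset.sum_const, nsmul_eq_mul, ht]
            push_cast
            rw [mul_one_div, div_le_div_iff₀ (by linarith) (by linarith)]
            linarith
          · have hval : ∀ z ∈ T, wgn M B (insert y (insert z B)) = 1 / (3 * ((p : ℚ) - 1)) := by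
              intro z hz
              rw [hD z hz y hy, hG3 ht3 z hz y hy, hryp]
              rw [if_neg (by omega), if_neg (by omega), if_pos rfl]
            rw [Finset.sum_congr rfl hval, Finset.sum_const, nsmul_eq_mul]
            have ht3q : (3 : ℚ) ≤ (T.card : ℚ) := by exact_mod_cast ht3
            have h3 : (3 : ℚ) * (1 / (3 * ((p : ℚ) - 1))) = 1 / ((p : ℚ) - 1) := by
              rw [mul_one_div, div_eq_div_iff (by linarith) (by linarith)]; ring
            rw [← h3]
            exact mul_le_mul_of_nonneg_right ht3q (div_nonneg zero_le_one (by linarith))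
        have hne : (p : ℚ) - 1 ≠ 0 := by linarith
        have : (p : ℚ) / ((p : ℚ) - 1) = 1 + 1 / ((p : ℚ) - 1) := by field_simp; ring
        linarith
    have := hsum_ge _ hper
    rw [hfq] at this
    have hne : (p : ℚ) - 1 ≠ 0 := by linarith
    have : ((p : ℚ) - 1) * ((p : ℚ) / ((p : ℚ) - 1)) = (p : ℚ) := by field_simp
    linarith

end GenDemD

end PercRepro
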